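import Summits.QuantumFields.YangMills.Theorems.BalabanUVNodesPortZDRecordChannel
import Summits.QuantumFields.YangMills.Theorems.BalabanUVNodesPortZDTransportHomogeneity

/-!
# NODE O port, row PT-A′ (PTZ-1, gen 3): (L)'s DIFFERENCE FUNCTIONAL AT THE RECORD IS THE LOG-MOMENT OF THE HISTORY FLUCTUATION — the [I] (2.12)–(2.14) structure row
# `PortZD.dChannel_eq_log_fluct` instantiated at the [Ax-4] names (`recordΦfAx − recordΦzAx`, transport `TβOfRecord₁₃ = TcanOfRecord` with its homogeneity DISCHARGED by
# `PortZD.hT_TcanOfRecord`, cut-off `chiβOfRecord₁₃Ax`, radius `θ.εbg`, clamped history `extd v`, charted field `W_B = unitField θ k K B`)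

[Balaban1987RG1] = [I] (CMP 109, 1987): (0.19) p. 255–256, (0.22) p. 256, (1.6) p. 261, (2.12)–(2.14) p. 268; [Balaban1988RG2Cluster] = [II] (CMP 116, 1988): Lemma 3 (2.38) p. 20, p. 21.

Seat `ymgap-nodeO-port-PTZ-1` g3 (prover, HELPER MODE; `--supports stmt-QuantumFields-26648 --as helper` per port-lead «SLOT RE-KEYED PT-A′ 26648 → PTZ-1 lineage … helpers open to all hands»
2026-08-31T01:00:34Z ∕ 01:20:13Z; NO `--workitem` — the CLOSE of 26648 is content-gated and is NOT attempted).  DEPENDENT row (CRIT-1 Q-5 (α): it names `recordΦfAx`, `recordΦzAx`,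
`chiβOfRecord₁₃Ax`): the one-line record corollary of this seat's generic rows `…PortZDHistoryFluctuation` (✓p805483) and `…PortZDTransportHomogeneity` (`hT_TcanOfRecord`), through gen 2's
`PortZDRecord.recordΦfAx_sub_recordΦzAx` (✓p801592: the (L) slot IS `𝓝 − 𝓝⁰` at the record, cast to `ℂ`).

WHAT IS PROVED (0 sorry; no `def` ∕ `instance` ∕ `notation`).  With `θ := thetaFill F a₀ ε₂₉`, `T := TβOfRecord₁₃ F 2`, `χ := chiβOfRecord₁₃Ax F 2 θ`, `g := extd v`, `W_B := unitField F θ k K B`,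
`A⁰_k := ZeroInput.mainTermT F 2 θ.εbg K g k`, `𝐄_k := ZeroInput.EkT F 2 T χ θ.εbg K g k`, `I(A) := χ_k·e^{−GF_k∕g_k² + A}`, `bg_W := Ū^k U_{k+1} W`:
* ★★ `recordChannel_eq_log_fluct` — if the zero-input step and the full step are defined at `W_B` and at `1` (the four transformed densities positive — DISPLAYED), then
  `recordΦfAx k v K B − recordΦzAx k v K B = ↑( log[T(I(A⁰_k + (𝐄_k − 𝐄_k(bg_{W_B}))))(W_B) ∕ T(I(A⁰_k))(W_B)] − log[T(I(A⁰_k + (𝐄_k − 𝐄_k(bg_1))))(1) ∕ T(I(A⁰_k))(1)] − 𝐄_k(bg_1) )` —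
  the (L) slot of the signed 26648 text is, VALUE BY VALUE, the log-moment of print's curly bracket `{𝐄_k(U_k(B̃′U_{k+1})) − 𝐄_k(U_{k+1})}` under the record's ZERO-INPUT step, normalised at the unit.
* ★★ `recordChannel_eq_log_fluct_of_gaugeInvariant` — with `GaugeInvariant A_k` at the record DISPLAYED (selection-dependent, CRIT-1 Q-3; `0 < a₀`, `k + 1 ≤ m + K`):
  `… = ↑( log⟨e^{𝐄_k − 𝐄_k(bg_{W_B})}⟩⁰_{W_B} − log[𝐍_k(A_k) ∕ 𝐍_k(A⁰_k)] )`.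
* `recordChannel_eq_zero_of_windowConst` — a window-constant `𝐄_k` (on co-null windows of the averaging kernel through which `T` is local at `W_B` and at `1` — DISPLAYED, the
  located (F)-species of node00) gives `recordΦfAx k v K B = recordΦzAx k v K B` ((2.14) read fibre-wise, the `k ≥ 1` analogue of gen 2's first-level germ rows).

HONEST FRAMING.  Record corollaries of kernel bookkeeping; the positivity, invariance and window hypotheses are DISPLAYED, not discharged; NOTHING of Bałaban's estimates asserted, ported
or discharged; 26648 ∕ 27930⁸ SIGNED·OPEN (content-gated: (Z) = Thm 3's step at zero input, (L) = [II] Lemma 3), 27931 OPEN (RC-3), 27932 CLOSED; K0⁷ ∕ K-Ax OPEN; counts unmoved;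
finite 𝕋⁴ at fixed ε — NOT continuum ∕ OS ∕ Clay; the Yang–Mills mass gap is NOT proved by any of this.  No `sorry`, no `instance`, no `notation`, no `def`.
-/

noncomputable section

namespace Summit.QuantumFields.YangMills.Theorems.PortZDRecord

open Literature.MathematicalPhysics.QuantumFieldTheory.Balaban1983to89
open Literature.MathematicalPhysics.QuantumFieldTheory.Balaban1983to89.Node00
open Literature.MathematicalPhysics.QuantumFieldTheory.Balaban1983to89.Node00.ZeroInput
open Literature.MathematicalPhysics.QuantumFieldTheory.Balaban1983to89.T4Continuum (T4Family)
open Summit.QuantumFields.YangMills.Theorems.K0RecordFormatNames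
open B12Eq019ActionBody (integrand normConst)
open GaugeField (GaugeInvariant)

variable (F : T4Family) (a₀ ε₂₉ : ℝ)

/-- ★★ **THE (L) SLOT AT THE RECORD IS THE LOG-MOMENT OF THE HISTORY FLUCTUATION UNDER THE ZERO-INPUT STEP** ((2.12)–(2.14) at the [Ax-4] names; the four step integrals
positive — displayed). [cite: Balaban1987RG1, (1.6) p.261, (2.12)–(2.14) p.268; Balaban1988RG2Cluster, p.21] -/
theorem recordChannel_eq_log_fluct (k : ℕ) (v : Fin (k + 1) → ℝ) (K : ℕ) (B : recordW F a₀ ε₂₉ k K)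
    (h0W : 0 < TβOfRecord₁₃ F 2 K k (integrand (chiβOfRecord₁₃Ax F 2 (thetaFill F a₀ ε₂₉) K (T4FlagMemory.extd v) k) (gfOfRecord F 2 K k) (T4FlagMemory.extd v k)
      (mainTermT F 2 (thetaFill F a₀ ε₂₉).εbg K (T4FlagMemory.extd v) k)) (unitField F (thetaFill F a₀ ε₂₉) k K B))
    (h01 : 0 < TβOfRecord₁₃ F 2 K k (integrand (chiβOfRecord₁₃Ax F 2 (thetaFill F a₀ ε₂₉) K (T4FlagMemory.extd v) k) (gfOfRecord F 2 K k) (T4FlagMemory.extd v k)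
      (mainTermT F 2 (thetaFill F a₀ ε₂₉).εbg K (T4FlagMemory.extd v) k)) 1)
    (hW : 0 < TβOfRecord₁₃ F 2 K k (integrand (chiβOfRecord₁₃Ax F 2 (thetaFill F a₀ ε₂₉) K (T4FlagMemory.extd v) k) (gfOfRecord F 2 K k) (T4FlagMemory.extd v k)
      (effActionHT F 2 (TβOfRecord₁₃ F 2) (chiβOfRecord₁₃Ax F 2 (thetaFill F a₀ ε₂₉)) K (T4FlagMemory.extd v) k)) (unitField F (thetaFill F a₀ ε₂₉) k K B))
    (h1 : 0 < TβOfRecord₁₃ F 2 K k (integrand (chiβOfRecord₁₃Ax F 2 (thetaFill F a₀ ε₂₉) K (T4FlagMemory.extd v) k) (gfOfRecord F 2 K k) (T4FlagMemory.extd v k)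
      (effActionHT F 2 (TβOfRecord₁₃ F 2) (chiβOfRecord₁₃Ax F 2 (thetaFill F a₀ ε₂₉)) K (T4FlagMemory.extd v) k)) 1) :
    letI θ := thetaFill F a₀ ε₂₉
    letI T := TβOfRecord₁₃ F 2
    letI χ := chiβOfRecord₁₃Ax F 2 θ
    letI g := T4FlagMemory.extd v
    letI W := unitField F θ k K B
    recordΦfAx F a₀ ε₂₉ k v K B - recordΦzAx F a₀ ε₂₉ k v K B =
      ((Real.log (T K k (integrand (χ K g k) (gfOfRecord F 2 K k) (g k)
            (mainTermT F 2 θ.εbg K g k + fun U => EkT F 2 T χ θ.εbg K g k U -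
              EkT F 2 T χ θ.εbg K g k (Averaging.iter (avOfRecord F 2 K) k (Uk F 2 K (k + 1) θ.εbg W)))) W /
          T K k (integrand (χ K g k) (gfOfRecord F 2 K k) (g k) (mainTermT F 2 θ.εbg K g k)) W) -
        Real.log (T K k (integrand (χ K g k) (gfOfRecord F 2 K k) (g k)
            (mainTermT F 2 θ.εbg K g k + fun U => EkT F 2 T χ θ.εbg K g k U -
              EkT F 2 T χ θ.εbg K g k (Averaging.iter (avOfRecord F 2 K) k (Uk F 2 K (k + 1) θ.εbg 1)))) 1 /
          T K k (integrand (χ K g k) (gfOfRecord F 2 K k) (g k) (mainTermT F 2 θ.εbg K g k)) 1) -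
        EkT F 2 T χ θ.εbg K g k (Averaging.iter (avOfRecord F 2 K) k (Uk F 2 K (k + 1) θ.εbg 1)) : ℝ) : ℂ) := by
  rw [recordΦfAx_sub_recordΦzAx,
    PortZD.dChannel_eq_log_fluct F 2 (TβOfRecord₁₃ F 2) (chiβOfRecord₁₃Ax F 2 (thetaFill F a₀ ε₂₉)) (thetaFill F a₀ ε₂₉).εbg K (T4FlagMemory.extd v) k
      (PortZD.hT_TcanOfRecord F 2 K k) _ h0W h01 hW h1]

/-- ★★ **THE SAME WITH THE UNIT NORMALISATION OF `𝐄_k`**: with `GaugeInvariant A_k` at the record DISPLAYED (`0 < a₀`, `k + 1 ≤ m + K`), the (L) slot is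
`↑( log⟨e^{𝐄_k − 𝐄_k(bg_{W_B})}⟩⁰_{W_B} − log[𝐍_k(A_k) ∕ 𝐍_k(A⁰_k)] )` — print's `N_k ∕ N_k^z` at the unit. [cite: Balaban1987RG1, (0.19) p.255–256, (1.6) p.261, (2.12)–(2.14) p.268, (2.16) p.269] -/
theorem recordChannel_eq_log_fluct_of_gaugeInvariant (ha₀ : 0 < a₀) {k : ℕ} (v : Fin (k + 1) → ℝ) {K : ℕ} (hk : k + 1 ≤ (F.P K).m + (F.P K).K)
    (B : recordW F a₀ ε₂₉ k K)
    (hinv : GaugeInvariant (effActionHT F 2 (TβOfRecord₁₃ F 2) (chiβOfRecord₁₃Ax F 2 (thetaFill F a₀ ε₂₉)) K (T4FlagMemory.extd v) k))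
    (h0W : 0 < TβOfRecord₁₃ F 2 K k (integrand (chiβOfRecord₁₃Ax F 2 (thetaFill F a₀ ε₂₉) K (T4FlagMemory.extd v) k) (gfOfRecord F 2 K k) (T4FlagMemory.extd v k)
      (mainTermT F 2 (thetaFill F a₀ ε₂₉).εbg K (T4FlagMemory.extd v) k)) (unitField F (thetaFill F a₀ ε₂₉) k K B))
    (h01 : 0 < TβOfRecord₁₃ F 2 K k (integrand (chiβOfRecord₁₃Ax F 2 (thetaFill F a₀ ε₂₉) K (T4FlagMemory.extd v) k) (gfOfRecord F 2 K k) (T4FlagMemory.extd v k)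
      (mainTermT F 2 (thetaFill F a₀ ε₂₉).εbg K (T4FlagMemory.extd v) k)) 1)
    (hW : 0 < TβOfRecord₁₃ F 2 K k (integrand (chiβOfRecord₁₃Ax F 2 (thetaFill F a₀ ε₂₉) K (T4FlagMemory.extd v) k) (gfOfRecord F 2 K k) (T4FlagMemory.extd v k)
      (effActionHT F 2 (TβOfRecord₁₃ F 2) (chiβOfRecord₁₃Ax F 2 (thetaFill F a₀ ε₂₉)) K (T4FlagMemory.extd v) k)) (unitField F (thetaFill F a₀ ε₂₉) k K B))
    (h1 : 0 < TβOfRecord₁₃ F 2 K k (integrand (chiβOfRecord₁₃Ax F 2 (thetaFill F a₀ ε₂₉) K (T4FlagMemory.extd v) k) (gfOfRecord F 2 K k) (T4FlagMemory.extd v k)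
      (effActionHT F 2 (TβOfRecord₁₃ F 2) (chiβOfRecord₁₃Ax F 2 (thetaFill F a₀ ε₂₉)) K (T4FlagMemory.extd v) k)) 1) :
    letI θ := thetaFill F a₀ ε₂₉
    letI T := TβOfRecord₁₃ F 2
    letI χ := chiβOfRecord₁₃Ax F 2 θ
    letI g := T4FlagMemory.extd v
    letI W := unitField F θ k K B
    recordΦfAx F a₀ ε₂₉ k v K B - recordΦzAx F a₀ ε₂₉ k v K B =
      ((Real.log (T K k (integrand (χ K g k) (gfOfRecord F 2 K k) (g k)
            (mainTermT F 2 θ.εbg K g k + fun U => EkT F 2 T χ θ.εbg K g k U -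
              EkT F 2 T χ θ.εbg K g k (Averaging.iter (avOfRecord F 2 K) k (Uk F 2 K (k + 1) θ.εbg W)))) W /
          T K k (integrand (χ K g k) (gfOfRecord F 2 K k) (g k) (mainTermT F 2 θ.εbg K g k)) W) -
        Real.log (normConst (T K k) (χ K g k) (gfOfRecord F 2 K k) (g k) (effActionHT F 2 T χ K g k) /
          normConst (T K k) (χ K g k) (gfOfRecord F 2 K k) (g k) (mainTermT F 2 θ.εbg K g k)) : ℝ) : ℂ) := by
  have hε : 0 < (thetaFill F a₀ ε₂₉).εbg := ha₀
  rw [recordΦfAx_sub_recordΦzAx,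
    PortZD.dChannel_eq_log_fluct_of_gaugeInvariant F 2 (TβOfRecord₁₃ F 2) (chiβOfRecord₁₃Ax F 2 (thetaFill F a₀ ε₂₉)) hε (T4FlagMemory.extd v) hk
      (PortZD.hT_TcanOfRecord F 2 K k) hinv _ h0W h01 hW h1]

/-- **A WINDOW-CONSTANT `𝐄_k` KILLS THE (L) SLOT**: if `T := TβOfRecord₁₃ F 2` is local at `W_B` through a window `S` and at `1` through `S₁` (displayed — node00's located
determinacy species), `𝐄_k = 𝐄_k(bg_{W_B})` on `S ∩ supp χ_k`, `𝐄_k = 0` on `S₁ ∩ supp χ_k`, `GaugeInvariant A_k` (displayed), the zero-input step's integrals at `W_B`, `1` non-zero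
(`0 < a₀`, `k + 1 ≤ m + K`), then `recordΦfAx k v K B = recordΦzAx k v K B` ((2.14) fibre-wise; the `k ≥ 1` analogue of gen 2's first-level germ rows).
[cite: Balaban1987RG1, (1.6) p.261, (2.14) p.268] -/
theorem recordChannel_eq_zero_of_windowConst (ha₀ : 0 < a₀) {k : ℕ} (v : Fin (k + 1) → ℝ) {K : ℕ} (hk : k + 1 ≤ (F.P K).m + (F.P K).K)
    (B : recordW F a₀ ε₂₉ k K)
    (hinv : GaugeInvariant (effActionHT F 2 (TβOfRecord₁₃ F 2) (chiβOfRecord₁₃Ax F 2 (thetaFill F a₀ ε₂₉)) K (T4FlagMemory.extd v) k))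
    {S S₁ : Set (GaugeField (F.P K) k (SU 2))}
    (hlocW : ∀ ρ ρ' : Density (F.P K) k (SU 2), (∀ U ∈ S, ρ U = ρ' U) →
      TβOfRecord₁₃ F 2 K k ρ (unitField F (thetaFill F a₀ ε₂₉) k K B) = TβOfRecord₁₃ F 2 K k ρ' (unitField F (thetaFill F a₀ ε₂₉) k K B))
    (hloc1 : ∀ ρ ρ' : Density (F.P K) k (SU 2), (∀ U ∈ S₁, ρ U = ρ' U) → TβOfRecord₁₃ F 2 K k ρ 1 = TβOfRecord₁₃ F 2 K k ρ' 1)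
    (h0W : TβOfRecord₁₃ F 2 K k (integrand (chiβOfRecord₁₃Ax F 2 (thetaFill F a₀ ε₂₉) K (T4FlagMemory.extd v) k) (gfOfRecord F 2 K k) (T4FlagMemory.extd v k)
      (mainTermT F 2 (thetaFill F a₀ ε₂₉).εbg K (T4FlagMemory.extd v) k)) (unitField F (thetaFill F a₀ ε₂₉) k K B) ≠ 0)
    (h01 : TβOfRecord₁₃ F 2 K k (integrand (chiβOfRecord₁₃Ax F 2 (thetaFill F a₀ ε₂₉) K (T4FlagMemory.extd v) k) (gfOfRecord F 2 K k) (T4FlagMemory.extd v k)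
      (mainTermT F 2 (thetaFill F a₀ ε₂₉).εbg K (T4FlagMemory.extd v) k)) 1 ≠ 0)
    (hEW : ∀ U ∈ S, chiβOfRecord₁₃Ax F 2 (thetaFill F a₀ ε₂₉) K (T4FlagMemory.extd v) k U ≠ 0 →
      EkT F 2 (TβOfRecord₁₃ F 2) (chiβOfRecord₁₃Ax F 2 (thetaFill F a₀ ε₂₉)) (thetaFill F a₀ ε₂₉).εbg K (T4FlagMemory.extd v) k U =
        EkT F 2 (TβOfRecord₁₃ F 2) (chiβOfRecord₁₃Ax F 2 (thetaFill F a₀ ε₂₉)) (thetaFill F a₀ ε₂₉).εbg K (T4FlagMemory.extd v) k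
          (Averaging.iter (avOfRecord F 2 K) k (Uk F 2 K (k + 1) (thetaFill F a₀ ε₂₉).εbg (unitField F (thetaFill F a₀ ε₂₉) k K B))))
    (hE1 : ∀ U ∈ S₁, chiβOfRecord₁₃Ax F 2 (thetaFill F a₀ ε₂₉) K (T4FlagMemory.extd v) k U ≠ 0 →
      EkT F 2 (TβOfRecord₁₃ F 2) (chiβOfRecord₁₃Ax F 2 (thetaFill F a₀ ε₂₉)) (thetaFill F a₀ ε₂₉).εbg K (T4FlagMemory.extd v) k U = 0) :
    recordΦfAx F a₀ ε₂₉ k v K B = recordΦzAx F a₀ ε₂₉ k v K B := by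
  have hε : 0 < (thetaFill F a₀ ε₂₉).εbg := ha₀
  rw [← sub_eq_zero, recordΦfAx_sub_recordΦzAx, Complex.ofReal_eq_zero]
  exact PortZD.dChannel_eq_zero_of_windowConst F 2 (TβOfRecord₁₃ F 2) (chiβOfRecord₁₃Ax F 2 (thetaFill F a₀ ε₂₉)) hε (T4FlagMemory.extd v) hk
    (PortZD.hT_TcanOfRecord F 2 K k) hinv _ hlocW hloc1 h0W h01 hEW hE1

end Summit.QuantumFields.YangMills.Theorems.PortZDRecord

end
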